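/-
Copyright (c) 2026. All rights reserved.
Released under Apache 2.0 license as described in the file LICENSE.
Authors: abc-iut cell — seat abc-iut-f-060 (block F fact-proving wave, tranche 60 of plan/F-TRANCHES.tsv:
FACT-LIST row F-0206 `CuspidalAlgorithm.RecoversCusps` of `AbsTopIChains.lean`, positive content).
-/
import Literature.AnabelianGeometry.AbsoluteAnabelian.AbsTopIChains
import HarnessLib

/-!
# [AbsTopI] Lemma 4.5 (v) as typed: existence criterion for a cusp-recovering functorial algorithm

S. Mochizuki, *Topics in Absolute Anabelian Geometry I: Generalities* [MochizukiAbsTopI2012], Lemma 4.5 (v)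
p. 55: "this correspondence is functorial in `H` and compatible with the natural actions by `Π` on both sides.
In particular, by allowing `H` to vary, this yields a ["group-theoretic"] characterization of the decomposition
groups of cusps in `Π`".  The parent file `AbsTopIChains.lean` (abc-iut-L4-t4) types the OUTPUT of such a
characterisation as the record `CuspidalAlgorithm` — a rule `E ↦ A.out E ⊆ {closed subgroups of Π_E}`, stable
under `Π`-conjugation and TRANSPORTED along every isomorphism `Π_E ≅ Π_F` carrying `Δ_E` onto `Δ_F` — and the
model-relative comparison as the predicate `A.RecoversCusps E C : A.out E = ⋃ₓ (conjugacy class of D_x)` for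
cuspidal data `C` (cell FACT-LIST row F-0206, a SCHEMA: its universal closure is false, see the sibling file
`AbsTopIChainsCuspidalFacts.lean`).

This PROOF-ONLY file (no `def` / `instance` / `structure`) records the positive content of the row at a NAMED
instance `(E, C)`: **a functorial algorithm recovering the cusps of `(E, C)` exists if and only if every
automorphism of the topological group `Π` carrying `Δ` onto `Δ` carries each `D_x` onto a `Π`-conjugate of some
`D_y`** (`CuspidalAlgorithm.exists_recoversCusps_iff`) — i.e. iff the cusp decomposition classes are
characteristic for the pair `Δ ⊴ Π`, which is exactly what "may be characterized group-theoretically" demands of a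
model.  (⇒) is the transport axiom at `F := E`; (⇐) is the algorithm "transport the classes of `C` along every
`Δ`-compatible isomorphism out of `Π_E`" (closed outputs: homeomorphic images of conjugates of the closed `D_x`;
conjugation-stability: `q·α(H)·q⁻¹ = α(α⁻¹(q)·H·α⁻¹(q)⁻¹)`; functoriality: composition of isomorphisms).

HONEST FRAMING: a theorem about the cell's typed interface records over abstract data; nothing of [AbsTopI] is
asserted to be proved for curves (the étale-`π₁` model is not available); a FACT-LIST row is an assumption label,
not an endorsement; no side is taken on [IUTchIII] Cor. 3.12; typed ≠ proved.
-/

namespace Literature.AnabelianGeometry.AbsoluteAnabelian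

open scoped Pointwise

universe u

namespace FundamentalExtension

variable (E : FundamentalExtension.{u})

/-! ### Transport lemmas -/

/-- Conjugation commutes with transport along a group isomorphism: `q·α(H)·q⁻¹ = α(α⁻¹(q)·H·α⁻¹(q)⁻¹)`.
[folklore] -/
private theorem conj_smul_map_mulEquiv {P Q : Type u} [Group P] [Group Q] (α : P ≃* Q) (H : Subgroup P) (q : Q) :
    MulAut.conj q • H.map α.toMonoidHom = (MulAut.conj (α.symm q) • H).map α.toMonoidHom := by
  ext y
  simp only [Subgroup.mem_smul_pointwise_iff_exists, Subgroup.mem_map, MulAut.smul_def, MulAut.conj_apply,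
    MulEquiv.coe_toMonoidHom]
  constructor
  · rintro ⟨s, ⟨h, hh, rfl⟩, rfl⟩
    exact ⟨α.symm q * h * (α.symm q)⁻¹, ⟨h, hh, rfl⟩, by simp⟩
  · rintro ⟨s, ⟨h, hh, rfl⟩, rfl⟩
    exact ⟨α h, ⟨h, hh, rfl⟩, by simp⟩

/-- A `Π`-conjugate of a closed subgroup of a topological group is closed. [folklore] -/
private theorem isClosed_conj_smul' {P : Type u} [Group P] [TopologicalSpace P] [IsTopologicalGroup P]
    {D : Subgroup P} (hD : IsClosed (D : Set P)) (g : P) :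
    IsClosed ((MulAut.conj g • D : Subgroup P) : Set P) := by
  have h : ((MulAut.conj g • D : Subgroup P) : Set P) = (fun x : P => g⁻¹ * x * g) ⁻¹' (D : Set P) := by
    ext x
    rw [SetLike.mem_coe, Subgroup.mem_pointwise_smul_iff_inv_smul_mem, Set.mem_preimage, SetLike.mem_coe,
      MulAut.smul_def, MulAut.conj_inv_apply]
  rw [h]
  exact hD.preimage (by fun_prop)

/-- Transport of `Δ`-compatibility along a composite: if `α : Π_E ≅ Π_F` carries `Δ_E` onto `Δ_F` and
`β : Π_F ≅ Π_{F'}` carries `Δ_F` onto `Δ_{F'}`, then `α ≫ β` carries `Δ_E` onto `Δ_{F'}`.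
[cite: MochizukiAbsTopI2012, Lemma 4.5 (v) p.55] -/
theorem geom_map_trans {E F F' : FundamentalExtension.{u}} (α : E.arith ≃ₜ* F.arith) (β : F.arith ≃ₜ* F'.arith)
    (hα : E.geom.map α.toMulEquiv.toMonoidHom = F.geom) (hβ : F.geom.map β.toMulEquiv.toMonoidHom = F'.geom) :
    E.geom.map (α.trans β).toMulEquiv.toMonoidHom = F'.geom := by
  rw [← hβ, ← hα, Subgroup.map_map]
  rfl

/-- Transport of a subgroup along a composite isomorphism. [folklore] -/
private theorem map_trans_eq {E F F' : FundamentalExtension.{u}} (α : E.arith ≃ₜ* F.arith)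
    (β : F.arith ≃ₜ* F'.arith) (H : Subgroup E.arith) :
    H.map (α.trans β).toMulEquiv.toMonoidHom = (H.map α.toMulEquiv.toMonoidHom).map β.toMulEquiv.toMonoidHom := by
  rw [Subgroup.map_map]
  rfl

/-- Transport along `β ≫ β⁻¹` is the identity on subgroups. [folklore] -/
private theorem map_trans_symm_self {F F' : FundamentalExtension.{u}} (β : F.arith ≃ₜ* F'.arith) (H : Subgroup F.arith) :
    H.map (β.trans β.symm).toMulEquiv.toMonoidHom = H := by
  have : (β.trans β.symm).toMulEquiv.toMonoidHom = MonoidHom.id _ :=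
    MonoidHom.ext fun x => β.symm_apply_apply x
  rw [this, Subgroup.map_id]

/-- **EXISTENCE CRITERION for [AbsTopI] Lemma 4.5 (v) as typed** (the positive content of the schema F-0206 at a
named instance `(E, C)`): a functorial group-theoretic cuspidal algorithm whose output on `E` is exactly the set of
decomposition groups of cusps of `C` EXISTS if and only if every automorphism of the topological group `Π`
carrying `Δ` onto `Δ` carries each `D_x` to a `Π`-conjugate of some `D_y` (the cusp decomposition classes are
characteristic for the pair `Δ ⊴ Π`).  (⇒) is the transport axiom at `F := E`; (⇐) is the algorithm transporting
the classes of `C` along every `Δ`-compatible `Π_E ≅ Π_F`. [cite: MochizukiAbsTopI2012, Lemma 4.5 (v) p.55] -/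
theorem CuspidalAlgorithm.exists_recoversCusps_iff (C : CuspidalData E) :
    (∃ A : CuspidalAlgorithm.{u}, A.RecoversCusps E C) ↔
      ∀ α : E.arith ≃ₜ* E.arith, E.geom.map α.toMulEquiv.toMonoidHom = E.geom →
        ∀ x : C.Cusp, ∃ (y : C.Cusp) (g : E.arith),
          (C.Dcusp x).map α.toMulEquiv.toMonoidHom = MulAut.conj g • C.Dcusp y := by
  constructor
  · rintro ⟨A, hA⟩ α hα x
    have hA' : A.out E = ⋃ y : C.Cusp, C.decompositionClass y := hA
    have hx : C.Dcusp x ∈ A.out E := by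
      rw [hA']
      exact Set.mem_iUnion.mpr ⟨x, C.Dcusp_mem_decompositionClass x⟩
    have hx' : (C.Dcusp x).map α.toMulEquiv.toMonoidHom ∈ A.out E := by
      rw [A.transport E E α hα]
      exact Set.mem_image_of_mem _ hx
    rw [hA'] at hx'
    obtain ⟨y, hy⟩ := Set.mem_iUnion.mp hx'
    obtain ⟨g, hg⟩ := hy
    exact ⟨y, g, hg⟩
  · intro hchar
    -- the algorithm transported from `(E, C)`
    let out : ∀ F : FundamentalExtension.{u}, Set (Subgroup F.arith) := fun F =>
      {D' | ∃ α : E.arith ≃ₜ* F.arith, E.geom.map α.toMulEquiv.toMonoidHom = F.geom ∧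
        ∃ (x : C.Cusp) (g : E.arith), D' = (MulAut.conj g • C.Dcusp x).map α.toMulEquiv.toMonoidHom}
    refine ⟨{ out := out, isClosed_of_mem := ?_, conj_mem := ?_, transport := ?_ }, ?_⟩
    · -- outputs are closed: a homeomorphic image of a conjugate of a closed `D_x`
      rintro F D' ⟨α, -, x, g, rfl⟩
      rw [Subgroup.coe_map]
      exact α.toHomeomorph.isClosedMap _ (isClosed_conj_smul' (C.isClosed_Dcusp x) g)
    · -- outputs are conjugation-stable
      rintro F D' g' ⟨α, hα, x, g, rfl⟩
      refine ⟨α, hα, x, α.toMulEquiv.symm g' * g, ?_⟩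
      rw [conj_smul_map_mulEquiv, map_mul, mul_smul]
    · -- functorial transport along `β : Π_F ≅ Π_{F'}`
      intro F F' β hβ
      ext D''
      constructor
      · rintro ⟨α', hα', x, g, rfl⟩
        refine ⟨(MulAut.conj g • C.Dcusp x).map (α'.trans β.symm).toMulEquiv.toMonoidHom,
          ⟨α'.trans β.symm, ?_, x, g, rfl⟩, ?_⟩
        · refine geom_map_trans α' β.symm hα' ?_
          rw [← hβ, ← map_trans_eq, map_trans_symm_self]
        · change ((MulAut.conj g • C.Dcusp x).map (α'.trans β.symm).toMulEquiv.toMonoidHom).map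
              β.toMulEquiv.toMonoidHom = _
          rw [← map_trans_eq]
          exact congrArg (fun φ => (MulAut.conj g • C.Dcusp x).map φ)
            (MonoidHom.ext fun z => β.apply_symm_apply (α' z))
      · rintro ⟨D', ⟨α, hα, x, g, rfl⟩, rfl⟩
        exact ⟨α.trans β, geom_map_trans α β hα hβ, x, g, (map_trans_eq α β _).symm⟩
    · -- the output on `E` is the set of decomposition groups of cusps of `C`
      change out E = ⋃ y : C.Cusp, C.decompositionClass y
      ext D'
      rw [Set.mem_iUnion]
      constructor
      · rintro ⟨α, hα, x, g, rfl⟩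
        obtain ⟨y, g', hy⟩ := hchar α hα x
        refine ⟨y, α g * g', ?_⟩
        have hg : α.toMulEquiv.symm (α g) = g := α.toMulEquiv.symm_apply_apply g
        rw [map_mul, mul_smul, ← hy, conj_smul_map_mulEquiv, hg]
      · rintro ⟨y, g, rfl⟩
        refine ⟨ContinuousMulEquiv.refl _, ?_, y, g, ?_⟩
        · exact Subgroup.map_id _
        · exact (Subgroup.map_id _).symm

end FundamentalExtension

end Literature.AnabelianGeometry.AbsoluteAnabelian
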